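import Summits.HodgeConjecture.HodgeConjecture.Theorems.F0P3cStCharTSVanDijkBoxOpp     -- ★ p851699 (LH6-p02 g6) (J3⁻): `bijOn_weylConj_vanDijk_box`; brings ★ (J3) p851676 `mapsTo_vanDijk_box`, ★ TN-CONJ, ★ regular twist
import Literature.NumberTheory.Automorphic.UnitaryGroupRankOneIwahoriDatum              -- ★ (F0P3-p01) `coe_comap_congruenceGL_eq_mul` (Iwahori factorisation of `K_γ ∩ U`), `weylLongU_mul_mul_weylLongU_mem_comap_congruenceGL`; brings `mul_comm_of_mem_torusU`
import Literature.NumberTheory.Automorphic.GLnCongruenceCommutators                     -- ★ p851695 (LH4-p02 g8) (L5): `exists_mem_comap_congruenceGL_conj_eq_mul`, `conj_mem_comap_congruenceGL`, `congruenceGL_mono`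
import HarnessLib

/-!
# F0 · P3c · line LH6 «StCharTS» — ROAD «JAC-LOC» brick (J4c) «TUBE ⊆ s·P̃»: the `K_γ`-saturation of the coset `s·T_γ` of a REGULAR split-torus element lies in
# the translate `s·P̃` of the ABELIAN SANDWICH `P̃ = N̄[γᾱ,γβ̄] ⊔ T_γ ⊔ N[γα,γβ] ⊔ K_ε` (Harish-Chandra 1970 Lemma 22; van Dijk 1972 §2; Rogawski 1990 §12.5 p. 182)

Cell `pub/hodgecm-mathlib`, crux H413 = `stmt-HodgeConjecture-24833` (lane `--supports … --as helper`), route HCCMUnconditional; seat LH6-p03 (g5), holder of the road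
«JAC-LOC» (memo `F0/P3b/LH6-p03/g5/ROAD-JAC-LOC.v2.LH6p03g5.md` §5 «PLAN v2», bus F0∕P3b 2026-09-02T14:11:30Z ∕ 14:31Z).  THEOREMS ONLY, sorry-free, no definition ∕
instance ∕ notation ∕ named fact.

SETTING (the MODEL of ★ `UnitaryGroupRankOneIwahoriDatum`): `K` a field with a valuative relation (`v := valuation K`), `σ` an isometric involution (`hσ`, `hv`), `2 ∈ Kˣ`, `J = Φ₃`,
`U = ↥(unitaryGroupOfForm σ J)`, `T = torusU σ J`, `N = unipotentU σ J` (★ Heisenberg chart `heisX`, `heisY`), `w₀ = weylLongU σ hJ`, levels `K_δ := (congruenceGL 3 δ).comap U.subtype`.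
For a REGULAR `s = diag(d) ∈ T`: root scalars `a = d₀⁻¹d₁`, `b = d₀⁻¹d₂` (★ (J3)) and, on the opposite side, `a_w = d₂⁻¹d₁`, `b_w = d₂⁻¹d₀` (★ (J3⁻)); the regular twists
`ψ_s(n) = s⁻¹ n s n⁻¹` on `N` and on `N̄ = w₀ N w₀⁻¹` map level-`γ` boxes onto the boxes `N[v(a−1)γ, v(b−1)γ]`, `N̄[v(a_w−1)γ, v(b_w−1)γ]` (★ `mapsTo_vanDijk_box`,
★ `bijOn_weylConj_vanDijk_box`).

THE RESULT **`inv_mul_conj_mem_sandwich`** ((J4c) of the memo): let `B`, `Bbar ≤ U` be subgroups whose carriers CONTAIN those two image boxes (hypotheses `hB`, `hBbar`; (J2)∕(J4a)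
deliver them as genuine subgroups), `B ≤ K_γ′`, `γ ≤ γ′`, `γ·γ′ ≤ ε`, `γ < 1`, `v(½)·γ ≤ 1`, and the two depth conditions of ★ (J3)∕(J3⁻) at radius `(γ, γ)`.  Then for every
`k ∈ K_γ` and every `τ ∈ K_γ ∩ T`:
  **`s⁻¹ · (k s τ k⁻¹) ∈ Bbar ⊔ ((K_γ ⊓ T) ⊔ (B ⊔ K_ε))`** — i.e. `Ad(K_γ)(s·T_γ) ⊆ s · P̃`.
PROOF (memo §5 (J4c), τ₀ absorbed): Iwahori-factorise `k = n̄ τ₀ n` (★ `coe_comap_congruenceGL_eq_mul`); `n₁ := τ₀ n τ₀⁻¹ ∈ N ∩ K_γ` and `τ₀` commutes with `s τ`, so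
`k s τ k⁻¹ = n̄ n₁ (sτ) n₁⁻¹ n̄⁻¹` and (group identity)
  `s⁻¹ (n̄ n₁ sτ n₁⁻¹ n̄⁻¹) = ψ̄_s(n̄) · n̄ (ψ_s(n₁) · (n₁ τ n₁⁻¹)) n̄⁻¹`;
`ψ̄_s(n̄) ∈ Bbar` ((J3⁻), `n̄ = w₀ m w₀⁻¹` with `m` in the level-`γ` box by §1), `ψ_s(n₁) ∈ B` ((J3), §1), `n₁ τ n₁⁻¹ = τ·c` with `c ∈ K_{γγ} ≤ K_ε` and
`n̄ X n̄⁻¹ = X·c′` with `c′ ∈ K_{γγ′} ≤ K_ε` (★ (L5) `exists_mem_comap_congruenceGL_conj_eq_mul`); every factor lies in the subgroup `P̃`.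

* §1 `valuation_heisX_le_of_mem`, `valuation_heisY_le_of_mem` — (L1) forward: `n ∈ N ∩ K_γ ⇒ v(x n) ≤ γ`, and `v(y n) ≤ γ` when `v(½)γ ≤ 1` (entries `(0,1)`, `(0,2)` of `↑n − 1`).
* §2 `exists_nbar_unipotent_eq_of_mem` — `k ∈ K_γ ⇒ ∃ m n₁ ∈ N ∩ K_γ, ∃ τ₀ ∈ T ∩ K_γ, k = (w₀ m w₀⁻¹) n₁ τ₀` (★ factorisation, `τ₀` moved to the right).
* §3 `inv_mul_conj_mem_sandwich` — (J4c).

HONEST LABEL: count-neutral algebra for the road «JAC-LOC» (hyperbolic half of the print residue «WIF» of the (S-𝔇) organ `stub_EllipticPackage`); closes no organ.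
HC_CM is proved only modulo the 7 printed citations (2 remaining: hLiu418 = `stmt-HodgeConjecture-24832`, h413 = `stmt-HodgeConjecture-24833`) until rung 0 closes.

## References
* [HarishChandra1970] Harish-Chandra, *Harmonic analysis on reductive p-adic groups*, LNM 162 (1970), Lemma 22.
* [vanDijk1972] G. van Dijk, *Computation of certain induced characters of p-adic groups*, Math. Ann. 199 (1972) 229–240, §2.
* [Casselman1995] W. Casselman, *Introduction to the theory of admissible representations of p-adic reductive groups* (1995), Prop. 1.4.4 (Iwahori factorisation).
* [Rogawski1990] J. D. Rogawski, *Automorphic Representations of Unitary Groups in Three Variables*, Ann. of Math. Stud. 123 (1990), §1.10 p. 9, §12.5 p. 182.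
-/

set_option autoImplicit false
-- the mandated namespace has the single-problem summit's repeated segment (`HodgeConjecture.HodgeConjecture`)
set_option linter.dupNamespace false

open Matrix ValuativeRel
open Literature.NumberTheory.Automorphic Literature.NumberTheory.Automorphic.UnitaryGroup Literature.NumberTheory.Automorphic.UnitaryGroup.HeisRing
open Literature.NumberTheory.Rogawski1990
open Summit.HodgeConjecture.HodgeConjecture.Cruxes.H413.F0P3cStCharTSVanDijkBox
open Summit.HodgeConjecture.HodgeConjecture.Cruxes.H413.F0P3cStCharTSVanDijkBoxOpp
open scoped MatrixGroups Pointwise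

namespace Summit.HodgeConjecture.HodgeConjecture.Cruxes.H413.F0P3cStCharTSTubeSubsetSandwich

variable {K : Type*} [Field K] [ValuativeRel K] (σ : K →+* K) (hσ : ∀ x, σ (σ x) = x) [Invertible (2 : K)]
  {J : Matrix (Fin 3) (Fin 3) K} (hJ : J = (StdForm.antidiagonal 3).over K)

/-! ## §1 (L1) forward: the coordinates of an element of `N ∩ K_γ` -/

omit [Invertible (2 : K)] in
/-- **`n ∈ N ∩ K_γ ⇒ v(x n) ≤ γ`** (`x(n)` is the entry `(0,1)` of `↑n`, which is the entry `(0,1)` of `↑n − 1`). [cite: Casselman1995, Prop. 1.4.4] -/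
theorem valuation_heisX_le_of_mem {γ : ValueGroupWithZero K} (n : ↥(unipotentU σ J))
    (hn : (n : ↥(unitaryGroupOfForm σ J)) ∈ (congruenceGL 3 γ).comap (unitaryGroupOfForm σ J).subtype) :
    valuation K (heisX σ n) ≤ γ := by
  have h := valuation_apply_sub_one_le_of_mem_congruenceGL (Subgroup.mem_comap.1 hn) 0 1
  rw [if_neg (by decide), sub_zero] at h
  exact h

/-- **`n ∈ N ∩ K_γ ⇒ v(y n) ≤ γ`** when `v(½)·γ ≤ 1`: `y = u₀₂ + ½ x σx` with `v(u₀₂) ≤ γ` and `v(½ x σx) ≤ v(½)γ² ≤ γ` (`v ∘ σ = v`).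
[cite: Casselman1995, Prop. 1.4.4] [cite: Rogawski1990, §1.10 p. 9] -/
theorem valuation_heisY_le_of_mem (hv : ∀ x, valuation K (σ x) = valuation K x) {γ : ValueGroupWithZero K}
    (h2γ : valuation K (⅟(2 : K)) * γ ≤ 1) (n : ↥(unipotentU σ J))
    (hn : (n : ↥(unitaryGroupOfForm σ J)) ∈ (congruenceGL 3 γ).comap (unitaryGroupOfForm σ J).subtype) :
    valuation K (heisY σ hσ hJ n : K) ≤ γ := by
  have hx := valuation_heisX_le_of_mem σ n hn
  have h02 := valuation_apply_sub_one_le_of_mem_congruenceGL (Subgroup.mem_comap.1 hn) 0 2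
  rw [if_neg (by decide), sub_zero] at h02
  rw [coe_heisY]
  refine Valuation.map_add_le _ h02 ?_
  rw [map_mul, map_mul, hv]
  calc valuation K (⅟(2 : K)) * (valuation K (heisX σ n) * valuation K (heisX σ n))
      ≤ valuation K (⅟(2 : K)) * (γ * γ) := mul_le_mul' le_rfl (mul_le_mul' hx hx)
    _ = (valuation K (⅟(2 : K)) * γ) * γ := by rw [mul_assoc]
    _ ≤ 1 * γ := mul_le_mul' h2γ le_rfl
    _ = γ := one_mul γ

/-! ## §2 The Iwahori factorisation with the torus part on the right -/

omit [Invertible (2 : K)] in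
/-- **`k ∈ K_γ ⇒ k = (w₀ m w₀⁻¹) · n₁ · τ₀`** with `m, n₁ ∈ N ∩ K_γ`, `τ₀ ∈ T ∩ K_γ` (`γ < 1`): ★ `coe_comap_congruenceGL_eq_mul` gives `k = n̄ τ₀ n` with `n̄ = w₀ m w₀⁻¹`
(`m = w₀ n̄ w₀ ∈ K_γ`, ★ `weylLongU_mul_mul_weylLongU_mem_comap_congruenceGL`); move `τ₀` to the right with `n₁ := τ₀ n τ₀⁻¹ ∈ N ∩ K_γ`.
[cite: Casselman1995, Prop. 1.4.4] -/
theorem exists_nbar_unipotent_eq_of_mem {γ : ValueGroupWithZero K} (hγ : γ < 1) {k : ↥(unitaryGroupOfForm σ J)}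
    (hk : k ∈ (congruenceGL 3 γ).comap (unitaryGroupOfForm σ J).subtype) :
    ∃ m n₁ : ↥(unipotentU σ J), ∃ τ₀ : ↥(unitaryGroupOfForm σ J),
      (m : ↥(unitaryGroupOfForm σ J)) ∈ (congruenceGL 3 γ).comap (unitaryGroupOfForm σ J).subtype ∧
      (n₁ : ↥(unitaryGroupOfForm σ J)) ∈ (congruenceGL 3 γ).comap (unitaryGroupOfForm σ J).subtype ∧
      τ₀ ∈ (congruenceGL 3 γ).comap (unitaryGroupOfForm σ J).subtype ∧ τ₀ ∈ torusU σ J ∧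
      k = (weylLongU σ hJ * (m : ↥(unitaryGroupOfForm σ J)) * (weylLongU σ hJ)⁻¹) * (n₁ : ↥(unitaryGroupOfForm σ J)) * τ₀ := by
  have hmem : k ∈ (((congruenceGL 3 γ).comap (unitaryGroupOfForm σ J).subtype : Subgroup ↥(unitaryGroupOfForm σ J)) : Set ↥(unitaryGroupOfForm σ J)) := hk
  rw [coe_comap_congruenceGL_eq_mul σ hJ hγ] at hmem
  obtain ⟨x, hx, n, hn, hxn⟩ := Set.mem_mul.1 hmem
  obtain ⟨nb, hnb, τ₀, hτ₀, hnbt⟩ := Set.mem_mul.1 hx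
  -- unpack the three memberships
  have hnb' := (Subgroup.mem_inf.1 hnb)
  have hτ₀' := (Subgroup.mem_inf.1 hτ₀)
  have hn' := (Subgroup.mem_inf.1 hn)
  obtain ⟨m, hmN, hm⟩ := Subgroup.mem_map.1 hnb'.2
  have hwinv : (weylLongU σ hJ)⁻¹ = weylLongU σ hJ := (eq_inv_of_mul_eq_one_left (weylLongU_mul_weylLongU σ hJ)).symm
  have hm' : weylLongU σ hJ * m * (weylLongU σ hJ)⁻¹ = nb := hm
  have hτ₀T : τ₀ ∈ torusU σ J := by simpa only [borelTriple_M] using hτ₀'.2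
  have hnN : n ∈ unipotentU σ J := by simpa only [borelTriple_N] using hn'.2
  have hmN' : m ∈ unipotentU σ J := by simpa only [borelTriple_N] using hmN
  -- `m ∈ K_γ`: `m = w₀ nb w₀`
  have hmK : m ∈ (congruenceGL 3 γ).comap (unitaryGroupOfForm σ J).subtype := by
    have h1 : weylLongU σ hJ * nb * weylLongU σ hJ = m := by
      rw [← hm']
      calc weylLongU σ hJ * (weylLongU σ hJ * m * (weylLongU σ hJ)⁻¹) * weylLongU σ hJ
          = (weylLongU σ hJ * weylLongU σ hJ) * m * ((weylLongU σ hJ)⁻¹ * weylLongU σ hJ) := by group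
        _ = m := by rw [weylLongU_mul_weylLongU σ hJ, inv_mul_cancel, one_mul, mul_one]
    rw [← h1]
    exact weylLongU_mul_mul_weylLongU_mem_comap_congruenceGL σ hJ hnb'.1
  -- `n₁ := τ₀ n τ₀⁻¹ ∈ N ∩ K_γ`
  have hn₁N : τ₀ * n * τ₀⁻¹ ∈ unipotentU σ J := by
    have h := (borelU_le_normalizer σ J) (torusU_le_borelU σ J hτ₀T)
    rw [Subgroup.mem_normalizer_iff] at h
    exact (h n).1 hnN
  have hn₁K : τ₀ * n * τ₀⁻¹ ∈ (congruenceGL 3 γ).comap (unitaryGroupOfForm σ J).subtype :=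
    Subgroup.mul_mem _ (Subgroup.mul_mem _ hτ₀'.1 hn'.1) (Subgroup.inv_mem _ hτ₀'.1)
  refine ⟨⟨m, hmN'⟩, ⟨τ₀ * n * τ₀⁻¹, hn₁N⟩, τ₀, hmK, hn₁K, hτ₀'.1, hτ₀T, ?_⟩
  change k = weylLongU σ hJ * m * (weylLongU σ hJ)⁻¹ * (τ₀ * n * τ₀⁻¹) * τ₀
  rw [hm', ← hxn, ← hnbt]
  group

/-! ## §3 (J4c) `Ad(K_γ)(s·T_γ) ⊆ s·P̃` -/

include hσ in
/-- **(J4c) TUBE ⊆ s·P̃.**  For a REGULAR `s = diag(d) ∈ T`, levels `γ ≤ γ′ < 1` with `γγ′ ≤ ε`, `v(½)γ ≤ 1`, the depth conditions of ★ (J3)∕(J3⁻) at radius `(γ,γ)`, and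
subgroups `B ≤ K_γ′`, `Bbar` containing the image boxes `N[v(a−1)γ, v(b−1)γ]` and `w₀·N[v(a_w−1)γ, v(b_w−1)γ]·w₀⁻¹`: for all `k ∈ K_γ` and `τ ∈ T ∩ K_γ`,
**`s⁻¹ (k s τ k⁻¹) ∈ Bbar ⊔ ((K_γ ⊓ T) ⊔ (B ⊔ K_ε))`** — the `K_γ`-saturation of `s·T_γ` lies in `s · P̃` (memo §5). [cite: HarishChandra1970, Lemma 22]
[cite: vanDijk1972, §2] [cite: Casselman1995, Prop. 1.4.4] [cite: Rogawski1990, §12.5 p. 182] -/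
theorem inv_mul_conj_mem_sandwich (hv : ∀ x, valuation K (σ x) = valuation K x)
    (s : ↥(torusU σ J)) (hreg : IsRegularElt ((s : ↥(unitaryGroupOfForm σ J)) : GL (Fin 3) K))
    {d : Fin 3 → Kˣ} (hd : glDiagonal 3 K d = ((s : ↥(unitaryGroupOfForm σ J)) : GL (Fin 3) K))
    {γ γ' ε : ValueGroupWithZero K} (hγ : γ < 1) (hγγ' : γ ≤ γ') (hε : γ * γ' ≤ ε) (h2γ : valuation K (⅟(2 : K)) * γ ≤ 1)
    (hρ : valuation K (⅟(2 : K)) * valuation K ((((d 0)⁻¹ * d 1 : Kˣ) : K) - σ (((d 0)⁻¹ * d 1 : Kˣ) : K)) * (γ * γ) ≤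
      valuation K ((((d 0)⁻¹ * d 2 : Kˣ) : K) - 1) * γ)
    (hρw : valuation K (⅟(2 : K)) * valuation K ((((d 2)⁻¹ * d 1 : Kˣ) : K) - σ (((d 2)⁻¹ * d 1 : Kˣ) : K)) * (γ * γ) ≤
      valuation K ((((d 2)⁻¹ * d 0 : Kˣ) : K) - 1) * γ)
    (B Bbar : Subgroup ↥(unitaryGroupOfForm σ J))
    (hBK : B ≤ (congruenceGL 3 γ').comap (unitaryGroupOfForm σ J).subtype)
    (hB : ∀ n : ↥(unipotentU σ J), valuation K (heisX σ n) ≤ valuation K ((((d 0)⁻¹ * d 1 : Kˣ) : K) - 1) * γ →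
      valuation K (heisY σ hσ hJ n : K) ≤ valuation K ((((d 0)⁻¹ * d 2 : Kˣ) : K) - 1) * γ → (n : ↥(unitaryGroupOfForm σ J)) ∈ B)
    (hBbar : ∀ n : ↥(unipotentU σ J), valuation K (heisX σ n) ≤ valuation K ((((d 2)⁻¹ * d 1 : Kˣ) : K) - 1) * γ →
      valuation K (heisY σ hσ hJ n : K) ≤ valuation K ((((d 2)⁻¹ * d 0 : Kˣ) : K) - 1) * γ →
        weylLongU σ hJ * (n : ↥(unitaryGroupOfForm σ J)) * (weylLongU σ hJ)⁻¹ ∈ Bbar)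
    {k : ↥(unitaryGroupOfForm σ J)} (hk : k ∈ (congruenceGL 3 γ).comap (unitaryGroupOfForm σ J).subtype)
    {τ : ↥(unitaryGroupOfForm σ J)} (hτK : τ ∈ (congruenceGL 3 γ).comap (unitaryGroupOfForm σ J).subtype) (hτT : τ ∈ torusU σ J) :
    (s : ↥(unitaryGroupOfForm σ J))⁻¹ * (k * s * τ * k⁻¹) ∈
      Bbar ⊔ ((((congruenceGL 3 γ).comap (unitaryGroupOfForm σ J).subtype) ⊓ torusU σ J) ⊔
        (B ⊔ (congruenceGL 3 ε).comap (unitaryGroupOfForm σ J).subtype)) := by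
  -- names for the four pieces and the sandwich
  set Kγ := (congruenceGL 3 γ).comap (unitaryGroupOfForm σ J).subtype with hKγ
  set Kε := (congruenceGL 3 ε).comap (unitaryGroupOfForm σ J).subtype with hKε
  set P := Bbar ⊔ ((Kγ ⊓ torusU σ J) ⊔ (B ⊔ Kε)) with hP
  have hBbarP : Bbar ≤ P := le_sup_left
  have hCP : Kγ ⊓ torusU σ J ≤ P := le_sup_left.trans le_sup_right
  have hBP : B ≤ P := (le_sup_left.trans le_sup_right).trans le_sup_right
  have hEP : Kε ≤ P := (le_sup_right.trans le_sup_right).trans le_sup_right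
  -- level arithmetic
  have hγγK : (congruenceGL 3 (γ * γ)).comap (unitaryGroupOfForm σ J).subtype ≤ Kε :=
    Subgroup.comap_mono (congruenceGL_mono ((mul_le_mul' le_rfl hγγ').trans hε))
  have hγγ'K : (congruenceGL 3 (γ * γ')).comap (unitaryGroupOfForm σ J).subtype ≤ Kε :=
    Subgroup.comap_mono (congruenceGL_mono hε)
  have hγK : Kγ ≤ (congruenceGL 3 γ').comap (unitaryGroupOfForm σ J).subtype := Subgroup.comap_mono (congruenceGL_mono hγγ')
  -- §2: `k = (w₀ m w₀⁻¹) n₁ τ₀`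
  obtain ⟨m, n₁, τ₀, hmK, hn₁K, hτ₀K, hτ₀T, hkfac⟩ := exists_nbar_unipotent_eq_of_mem σ hJ hγ hk
  have hw₀ : (((weylLongU σ hJ : ↥(unitaryGroupOfForm σ J)) : GL (Fin 3) K) : Matrix (Fin 3) (Fin 3) K) = J := coe_coe_weylLongU σ hJ
  have hwinv : (weylLongU σ hJ)⁻¹ = weylLongU σ hJ := (eq_inv_of_mul_eq_one_left (weylLongU_mul_weylLongU σ hJ)).symm
  obtain ⟨nb, hnbdef⟩ : ∃ nb : ↥(unitaryGroupOfForm σ J), nb = weylLongU σ hJ * (m : ↥(unitaryGroupOfForm σ J)) * (weylLongU σ hJ)⁻¹ := ⟨_, rfl⟩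
  rw [← hnbdef] at hkfac
  -- `τ₀` commutes with `s` and `τ`; rewrite the tube element without `τ₀`
  have hsτ₀ : τ₀ * ((s : ↥(unitaryGroupOfForm σ J)) * τ) * τ₀⁻¹ = (s : ↥(unitaryGroupOfForm σ J)) * τ := by
    rw [mul_comm_of_mem_torusU σ hτ₀T (Subgroup.mul_mem _ s.2 hτT), mul_inv_cancel_right]
  have hkey : (s : ↥(unitaryGroupOfForm σ J))⁻¹ * (k * s * τ * k⁻¹) =
      ((s : ↥(unitaryGroupOfForm σ J))⁻¹ * nb * s * nb⁻¹) *
        (nb * ((((s : ↥(unitaryGroupOfForm σ J))⁻¹ * n₁ * s * (n₁ : ↥(unitaryGroupOfForm σ J))⁻¹) *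
          ((n₁ : ↥(unitaryGroupOfForm σ J)) * τ * (n₁ : ↥(unitaryGroupOfForm σ J))⁻¹))) * nb⁻¹) := by
    have e1 : k * s * τ * k⁻¹ = nb * n₁ * ((s : ↥(unitaryGroupOfForm σ J)) * τ) * (n₁ : ↥(unitaryGroupOfForm σ J))⁻¹ * nb⁻¹ := by
      rw [hkfac]
      calc nb * ↑n₁ * τ₀ * ↑s * τ * (nb * ↑n₁ * τ₀)⁻¹ = nb * ↑n₁ * (τ₀ * (↑s * τ) * τ₀⁻¹) * (↑n₁)⁻¹ * nb⁻¹ := by group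
        _ = nb * ↑n₁ * (↑s * τ) * (↑n₁)⁻¹ * nb⁻¹ := by rw [hsτ₀]
    rw [e1]
    group
  rw [hkey]
  -- the four memberships
  -- (i) `ψ̄_s(nb) ∈ Bbar` by ★ (J3⁻)
  have hmx : valuation K (heisX σ m) ≤ γ := valuation_heisX_le_of_mem σ m hmK
  have hmy : valuation K (heisY σ hσ hJ m : K) ≤ γ := valuation_heisY_le_of_mem σ hσ hJ hv h2γ m hmK
  have hbij := bijOn_weylConj_vanDijk_box σ hσ hJ (valuation K) hv (weylLongU σ hJ) hw₀ s hreg hd hρw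
  have hnb_mem : nb ∈ (fun m' : ↥(unipotentU σ J) => weylLongU σ hJ * (m' : ↥(unitaryGroupOfForm σ J)) * (weylLongU σ hJ)⁻¹) ''
      {m' | valuation K (heisX σ m') ≤ γ ∧ valuation K (heisY σ hσ hJ m' : K) ≤ γ} := ⟨m, ⟨hmx, hmy⟩, hnbdef.symm⟩
  obtain ⟨n', ⟨hn'x, hn'y⟩, hn'eq⟩ := hbij.mapsTo hnb_mem
  have hn'eq' : weylLongU σ hJ * (n' : ↥(unitaryGroupOfForm σ J)) * (weylLongU σ hJ)⁻¹ =
      (s : ↥(unitaryGroupOfForm σ J))⁻¹ * nb * s * nb⁻¹ := hn'eq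
  have h1 : (s : ↥(unitaryGroupOfForm σ J))⁻¹ * nb * s * nb⁻¹ ∈ P := by
    apply hBbarP
    have := hBbar n' hn'x hn'y
    rw [hn'eq'] at this
    exact this
  -- (ii) `ψ_s(n₁) ∈ B` by ★ (J3)
  have hn₁x : valuation K (heisX σ n₁) ≤ γ := valuation_heisX_le_of_mem σ n₁ hn₁K
  have hn₁y : valuation K (heisY σ hσ hJ n₁ : K) ≤ γ := valuation_heisY_le_of_mem σ hσ hJ hv h2γ n₁ hn₁K
  have hmaps := mapsTo_vanDijk_box σ hσ hJ (valuation K) hv s hd hρ (show n₁ ∈ {n' | valuation K (heisX σ n') ≤ γ ∧ valuation K (heisY σ hσ hJ n' : K) ≤ γ} from ⟨hn₁x, hn₁y⟩)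
  have h2 : (s : ↥(unitaryGroupOfForm σ J))⁻¹ * n₁ * s * (n₁ : ↥(unitaryGroupOfForm σ J))⁻¹ ∈ B := by
    have hB' := hB (torusConj σ s n₁ * n₁⁻¹) hmaps.1 hmaps.2
    have hcoe : ((torusConj σ s n₁ * n₁⁻¹ : ↥(unipotentU σ J)) : ↥(unitaryGroupOfForm σ J)) =
        (s : ↥(unitaryGroupOfForm σ J))⁻¹ * n₁ * s * (n₁ : ↥(unitaryGroupOfForm σ J))⁻¹ := by
      rw [Subgroup.coe_mul, Subgroup.coe_inv, coe_torusConj]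
    rw [hcoe] at hB'
    exact hB'
  -- (iii) `n₁ τ n₁⁻¹ = τ · c`, `c ∈ K_{γγ} ≤ K_ε`
  obtain ⟨c, hc, hceq⟩ := exists_mem_comap_congruenceGL_conj_eq_mul (unitaryGroupOfForm σ J).subtype hn₁K hτK
  have h3 : (n₁ : ↥(unitaryGroupOfForm σ J)) * τ * (n₁ : ↥(unitaryGroupOfForm σ J))⁻¹ ∈ P := by
    rw [hceq]
    exact P.mul_mem (hCP (Subgroup.mem_inf.2 ⟨hτK, hτT⟩)) (hEP (hγγK hc))
  -- (iv) the inner product `X` lies in `P` and in `K_γ′`; conjugation by `nb ∈ K_γ` costs a factor in `K_{γγ′} ≤ K_ε`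
  have hX : ((s : ↥(unitaryGroupOfForm σ J))⁻¹ * n₁ * s * (n₁ : ↥(unitaryGroupOfForm σ J))⁻¹) *
      ((n₁ : ↥(unitaryGroupOfForm σ J)) * τ * (n₁ : ↥(unitaryGroupOfForm σ J))⁻¹) ∈ P := P.mul_mem (hBP h2) h3
  have hXK : ((s : ↥(unitaryGroupOfForm σ J))⁻¹ * n₁ * s * (n₁ : ↥(unitaryGroupOfForm σ J))⁻¹) *
      ((n₁ : ↥(unitaryGroupOfForm σ J)) * τ * (n₁ : ↥(unitaryGroupOfForm σ J))⁻¹) ∈ (congruenceGL 3 γ').comap (unitaryGroupOfForm σ J).subtype := by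
    refine Subgroup.mul_mem _ (hBK h2) ?_
    exact hγK (Subgroup.mul_mem _ (Subgroup.mul_mem _ hn₁K hτK) (Subgroup.inv_mem _ hn₁K))
  have hnbK : nb ∈ Kγ := by
    rw [hnbdef, hwinv]
    exact weylLongU_mul_mul_weylLongU_mem_comap_congruenceGL σ hJ hmK
  obtain ⟨c', hc', hc'eq⟩ := exists_mem_comap_congruenceGL_conj_eq_mul (unitaryGroupOfForm σ J).subtype hnbK hXK
  have h4 : nb * (((s : ↥(unitaryGroupOfForm σ J))⁻¹ * n₁ * s * (n₁ : ↥(unitaryGroupOfForm σ J))⁻¹) *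
      ((n₁ : ↥(unitaryGroupOfForm σ J)) * τ * (n₁ : ↥(unitaryGroupOfForm σ J))⁻¹)) * nb⁻¹ ∈ P := by
    rw [hc'eq]
    exact P.mul_mem hX (hEP (hγγ'K hc'))
  exact P.mul_mem h1 h4

end Summit.HodgeConjecture.HodgeConjecture.Cruxes.H413.F0P3cStCharTSTubeSubsetSandwich
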